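/-
Copyright (c) 2026 the pub-hodgecm-mathlib formalisation cell (harness21).  Prover seat hodgecm-mathlib-LH4-p15 (g2), req620 Track A «(D-RAM) FOUR-FRAME» squad
(STAGE-1b, row (2) of the piece `f_{T₊}`, the (β₂) road (R-36) «PURE-CELL LEDGER»; β₂ sub-dealer LH4-p04 (g10) WORD #24 ‹TERM.letter.v2› 78b8538f5e7a241e, holder LH4-p15 (g2):
(T-b5b) «THE LANE-B LITERAL DIGIT AND ITS SOCKET LETTERS»), 2026-09-05.
-/
import Summits.HodgeConjecture.HodgeConjecture.Theorems.F0P3cDyRamTerminalCellDigitFlip      -- ★ (this seat, T-b5a): the two flips of a row cell in lane B; `map_hatKappa_eq`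
import Summits.HodgeConjecture.HodgeConjecture.Theorems.F0P3cDyRamRowCellSphereTransport    -- ★ (LH4-p16 (g2)): `ncard_fibre_eq_ncard_fibre_of_sphere`'s fibre shape; brings ★ `trace_letters`
import Literature.NumberTheory.Automorphic.UnitaryThreeFourFrameDefs                          -- ★ Lit DEFS: `IsRamifiedQuadraticDatum`
import HarnessLib

/-!
# Crux `H413`, line LH4 «(D-RAM) FOUR-FRAME» — STAGE-1b, row (2), the (β₂) road (R-36), (ROW-TERM): «THE LANE-B LITERAL DIGIT AND ITS SOCKET LETTERS» — for LH4-p19 (g2)'s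
# three-way socket ★ p863833 on a row cell `(j, b)` the literal predicate **`LIT V :≡` (sphere) `∧` (realisable from a vertex)** is served: (hLit) every digit within `r` of a vertex
# digit is `LIT`; `LIT` is constant on `|V − V′| ≤ |ϖ|²`; two `LIT` digits carry a flip `εΘε = ρκ_{V′}∕ρκ_V`; and the socket's fibres ARE LH4-p16 (g2)'s sphere fibres

Cell `hodgecm-mathlib` (D-0151), FLOOR 0, crux item H413 = `stmt-HodgeConjecture-24833`, route of record `HCCMUnconditional`; squad F0∕P3c∕LH4; lane
`--supports stmt-HodgeConjecture-24833 --as helper` (count-neutral; pays NO tier-0 row).  THEOREMS ONLY (no `def`, no instance, no notation, no `sorry`, default heartbeats);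
★-only imports; states NO law; (β₂) stays a HYPOTHESIS.  One-field letters on the eigen-field `M` (`ρ, Θ` commuting involutions, `ρ` and `Θ` isometric), `jE : E → M` with
`Fix ρ = jE(E)`, `Θ∘jE = jE∘σ`, `jE` isometric; the cell `(j, b)` of ★ p863833 (`cc = ϖE^j`, `GEN` = its four clauses); the reference pair `(κ₀, ξ₀)` of LH4-p16's ★ p863914
(`Tr_ρ κ₀ = 1`, `κ₀, ξ₀ ∈ Fix Θ`, `ρξ₀ = −ξ₀`) AT THE CELL'S RADIUS: **`|ξ₀|·|cc(α − ρα)| = |ϖE|^b`** and `|κ₀| < |ξ₀|` (so the sphere `|κ| = R` is `|κ₀ + Vξ₀| = |ξ₀|`, `|V| = 1`);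
the lane-B norm suppliers `hFN`, `hN4` of ★ (T-b5a).
WHY (this seat's (ROW-TERM) plan; ★ (T-b5a) module docstring).  With `κ_V := κ₀ + jE V·ξ₀` and `κ̂(x₀) := ρu₀ ∕ Tr_ρ u₀` (`u₀ = h·x₀Θx₀`), define
`LIT V :≡ |κ_V|·|cc(α − ρα)| = |ϖE|^b ∧ ∃ Λ x₀, GEN Λ x₀ ∧ ∃ z, zΘz = ρκ_V ∕ ρκ̂(x₀)`.  Then: §2 (hLit) if `|Vf x₀ − jE V₀| ≤ r` with `r ≤ |ϖE|⁴` then `κ_{V₀}` is on the sphere and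
`ρκ_{V₀}∕ρκ̂(x₀) ≡ 1 (ϖE⁴)` is a `Θ`-norm (`hN4`); §3 `LIT` moves along `|V − V′| ≤ |ϖ|²` (sphere: strict ultrametric; flip: ★ (T-b5a) HEAD); §4 two `LIT` digits `y, y′` give
`εΘε = ρκ_{y′}∕ρκ_y` (vertex → `y`, vertex → vertex by ★ (T-b5a) (a), vertex → `y′`); §1 the socket's (hF) fibre `{∃ x₀, GEN ∧ (CLS ↔ ε) ∧ |Vf x₀ − jE y| ≤ r}` equals LH4-p16's sphere
fibre `{∃ x₀, GEN ∧ IsOrd(μ∕Y) ∧ (CLS ↔ ε) ∧ |κ̂(x₀) − κ_y| ≤ r·|ξ₀|}` once the cell is `u`-free (`levelSetDep = levelSet`, the socket's `hcell`); §0 the gap letter `hFgap` from the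
`E`-datum through `jE`.
* §0 `v_eq_one_of_fixed_fixed`; §1 `socketFibre_eq_sphereFibre`; §2 `sphere_and_flip_of_near`; §3 `sphere_and_flip_of_sub_le`; §4 `exists_flip_of_flips`.
WHAT IS NOT CLAIMED: (hF), (hbase), the instance for ‹TERM.v2›, any count, any census identity.
HONEST LABEL.  Count-neutral valuation ∕ lattice bookkeeping; nothing printed is asserted; no census law is stated; ‹TERM.v2› stays OPEN; `HC_CM` is proved only modulo the 7 printed
citations (2 remaining named inputs: hLiu418 = `stmt-HodgeConjecture-24832`, h413 = `stmt-HodgeConjecture-24833`) until rung 0 closes.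
## References
* [Kottwitz1986BaseChangeUnits] R. E. Kottwitz, *Base change for unit elements of Hecke algebras*, Compositio Math. 60 (1986): §1 pp. 240–241.
* [Jacobowitz1962] R. Jacobowitz, *Hermitian forms over local fields*, Amer. J. Math. 84 (1962): §4.
* [Serre1979] J.-P. Serre, *Local Fields*, GTM 67 (1979): Ch. III §6 Prop. 12; Ch. V §2 Prop. 3, §3 Cor. 3 pp. 84–86; Ch. XIV §6.
* [Flicker1998UnitaryFL] Y. Z. Flicker, *Elementary proof of the fundamental lemma for a unitary group*, Canad. J. Math. 50 (1998): Prop. 7 p. 84 (lattice transport).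
-/

set_option autoImplicit false

noncomputable section

namespace Summit.HodgeConjecture.HodgeConjecture.Cruxes.H413.F0P3cDyRamTerminalCellSocketLetters

open scoped Valued WithZero
open WithZero
open Literature.NumberTheory.Automorphic.UnitaryThreeFourFrame (IsRamifiedQuadraticDatum)
open Summit.HodgeConjecture.HodgeConjecture.Cruxes.H413.F0P3cDyRamToricCensusDefs
open Summit.HodgeConjecture.HodgeConjecture.Cruxes.H413.F0P3cDyRamRowCellFibreTransport (trace_letters)
open Summit.HodgeConjecture.HodgeConjecture.Cruxes.H413.F0P3cDyRamTerminalCellDigitFlip (map_hatKappa_eq exists_mul_theta_eq_hatKappa_flip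
  exists_mul_theta_eq_sphere_flip_of_near)

variable {E M : Type} [Field E] [Valued E ℤᵐ⁰] [Field M] [Valued M ℤᵐ⁰] {ρ Θ : M →+* M} {α : M}

/-! ## §0 The gap letter `hFgap` through `jE` -/

/-- **`hFgap` FROM THE `E`-DATUM**: a doubly-fixed `z ∈ M` is `jE c` with `σc = c`, whose valuation lies in `exp(2ℤ)`; so `|ϖE| < |z| ≤ 1` forces `|z| = 1`.
[cite: Serre1979, Ch. III §6 Prop. 12] -/
theorem v_eq_one_of_fixed_fixed {σ : E →+* E} {ϖ : E} {d tE : ℕ} (hD : IsRamifiedQuadraticDatum σ ϖ d tE)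
    (jE : E →+* M) (hjiso : ∀ c, Valued.v (jE c) = Valued.v c) (hjfix : ∀ z, ρ z = z ↔ ∃ c, jE c = z) (hΘj : ∀ c, Θ (jE c) = jE (σ c)) :
    ∀ z : M, ρ z = z → Θ z = z → Valued.v (jE ϖ) < Valued.v z → Valued.v z ≤ 1 → Valued.v z = 1 := by
  obtain ⟨-, -, hϖ, hfix, -⟩ := hD
  intro z hρz hΘz hlt hle
  obtain ⟨c, rfl⟩ := (hjfix z).1 hρz
  have hσc : σ c = c := jE.injective (by rw [← hΘj, hΘz])
  have hc0 : c ≠ 0 := fun h0 => by rw [h0, map_zero, Valuation.map_zero] at hlt; exact absurd hlt (not_lt.2 zero_le)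
  obtain ⟨n, hn⟩ := hfix c hσc hc0
  rw [hjiso, hjiso, hϖ, hn, exp_lt_exp] at hlt
  rw [hjiso, hn, ← exp_zero, exp_le_exp] at hle
  rw [hjiso, hn, ← exp_zero]
  congr 1; omega

/-! ## §1 The socket's fibre IS LH4-p16's sphere fibre -/

omit [Valued E ℤᵐ⁰] in
/-- **THE SOCKET FIBRE IS THE SPHERE FIBRE.**  With `Vf x₀ = (κ̂(x₀) − κ₀)∕ξ₀` (`ξ₀ ≠ 0`), `κ_y = κ₀ + jE y·ξ₀`, and the `u`-free cell (every `GEN` pair has the depth clause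
`IsOrd(μ∕Y)`): ★ p863833's (hF) fibre over `y` at tolerance `r` equals ★ `ncard_fibre_eq_ncard_fibre_of_sphere`'s fibre over `κ_y` at tolerance `r·|ξ₀|`.
[cite: Kottwitz1986BaseChangeUnits, §1 pp. 240–241] [cite: Jacobowitz1962, §4] -/
theorem socketFibre_eq_sphereFibre (jE : E →+* M) {ϖE cc hM μ κ₀ ξ₀ : M} (hξ0 : ξ₀ ≠ 0) {b : ℕ}
    (hdep : ∀ (Λ : AddSubgroup M) (x₀ : M), (x₀ ≠ 0 ∧ (∀ x, x ∈ Λ ↔ ∃ ζ, IsOrd ρ α cc ζ ∧ x = x₀ * ζ) ∧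
        IsOrd ρ α cc (dualGen ρ Θ α cc hM x₀) ∧ ¬ IsOrd ρ α cc (dualGen ρ Θ α cc hM x₀ / ϖE) ∧
        Valued.v (dualGen ρ Θ α cc hM x₀) = Valued.v ϖE ^ b) → IsOrd ρ α cc (μ / dualGen ρ Θ α cc hM x₀))
    (P : M → Prop) (ε : Prop) (r : ℤᵐ⁰) (y : E) :
    {Λ : AddSubgroup M | ∃ x₀ : M, (x₀ ≠ 0 ∧ (∀ x, x ∈ Λ ↔ ∃ ζ, IsOrd ρ α cc ζ ∧ x = x₀ * ζ) ∧
        IsOrd ρ α cc (dualGen ρ Θ α cc hM x₀) ∧ ¬ IsOrd ρ α cc (dualGen ρ Θ α cc hM x₀ / ϖE) ∧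
        Valued.v (dualGen ρ Θ α cc hM x₀) = Valued.v ϖE ^ b) ∧ (P x₀ ↔ ε) ∧
        Valued.v ((ρ (hM * (x₀ * Θ x₀)) / (hM * (x₀ * Θ x₀) + ρ (hM * (x₀ * Θ x₀))) - κ₀) / ξ₀ - jE y) ≤ r} =
      {Λ : AddSubgroup M | ∃ x₀ : M, x₀ ≠ 0 ∧ (∀ x, x ∈ Λ ↔ ∃ ζ, IsOrd ρ α cc ζ ∧ x = x₀ * ζ) ∧
        IsOrd ρ α cc (dualGen ρ Θ α cc hM x₀) ∧ ¬ IsOrd ρ α cc (dualGen ρ Θ α cc hM x₀ / ϖE) ∧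
        Valued.v (dualGen ρ Θ α cc hM x₀) = Valued.v ϖE ^ b ∧ IsOrd ρ α cc (μ / dualGen ρ Θ α cc hM x₀) ∧ (P x₀ ↔ ε) ∧
        Valued.v (ρ (hM * (x₀ * Θ x₀)) / (hM * (x₀ * Θ x₀) + ρ (hM * (x₀ * Θ x₀))) - (κ₀ + jE y * ξ₀)) ≤ r * Valued.v ξ₀} := by
  have hξpos : (0 : ℤᵐ⁰) < Valued.v ξ₀ := zero_lt_iff.2 ((Valuation.ne_zero_iff _).2 hξ0)
  have hdist : ∀ κ : M, Valued.v ((κ - κ₀) / ξ₀ - jE y) ≤ r ↔ Valued.v (κ - (κ₀ + jE y * ξ₀)) ≤ r * Valued.v ξ₀ := by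
    intro κ
    have e : (κ - κ₀) / ξ₀ - jE y = (κ - (κ₀ + jE y * ξ₀)) / ξ₀ := by field_simp; ring
    rw [e, map_div₀, div_le_iff₀ hξpos]
  ext Λ
  constructor
  · rintro ⟨x₀, hG, hC, hd⟩
    exact ⟨x₀, hG.1, hG.2.1, hG.2.2.1, hG.2.2.2.1, hG.2.2.2.2, hdep Λ x₀ hG, hC, (hdist _).1 hd⟩
  · rintro ⟨x₀, hx₀, hΛ, hyO, hyp, hylev, -, hC, hd⟩
    exact ⟨x₀, ⟨hx₀, hΛ, hyO, hyp, hylev⟩, hC, (hdist _).2 hd⟩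

/-! ## §2 (hLit) — a digit near a vertex digit is on the sphere and realisable from that vertex -/

/-- **(hLit) CORE.**  A cell pair `(Λ, x₀)` (the `GEN` clauses; `Θh = h ≠ 0`, `ρϖE = ϖE`, `0 < |ϖE| ≤ 1`, `1 ≤ b`, `cc(α − ρα) ≠ 0`, `hFgap`), the reference pair AT THE RADIUS
(`|ξ₀|·|cc(α − ρα)| = |ϖE|^b`), a `Θ`-fixed `W₀` with `|κ̂(x₀) − (κ₀ + W₀ξ₀)| ≤ r·|ξ₀|`, `r ≤ |ϖE|⁴ < 1`, and `hN4` ⟹ `κ₀ + W₀ξ₀` is on the sphere and `ρ(κ₀ + W₀ξ₀) ∕ ρκ̂(x₀)`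
is a `Θ`-norm. [cite: Kottwitz1986BaseChangeUnits, §1 pp. 240–241] [cite: Serre1979, Ch. V §3 Cor. 3 pp. 84–86] -/
theorem sphere_and_flip_of_near (hρρ : ∀ x, ρ (ρ x) = x) (hvρ : ∀ x, Valued.v (ρ x) = Valued.v x) (hΘΘ : ∀ x, Θ (Θ x) = x)
    (hΘρ : ∀ x, Θ (ρ x) = ρ (Θ x))
    {hM ϖE : M} (hΘh : Θ hM = hM) (hh : hM ≠ 0) (hρϖ : ρ ϖE = ϖE) (hϖ0 : ϖE ≠ 0) (hϖ1 : Valued.v ϖE ≤ 1) (hϖlt : Valued.v ϖE < 1)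
    {j b : ℕ} (hb1 : 1 ≤ b) (hcc : ϖE ^ j * (α - ρ α) ≠ 0)
    (hFgap : ∀ z : M, ρ z = z → Θ z = z → Valued.v ϖE < Valued.v z → Valued.v z ≤ 1 → Valued.v z = 1)
    (hN4 : ∀ u : M, Θ u = u → Valued.v (u - 1) ≤ Valued.v ϖE ^ 4 → ∃ z : M, z * Θ z = u)
    {κ₀ ξ₀ : M} (hΘκ₀ : Θ κ₀ = κ₀) (hΘξ : Θ ξ₀ = ξ₀) (hRξ : Valued.v ξ₀ * Valued.v (ϖE ^ j * (α - ρ α)) = Valued.v ϖE ^ b)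
    {x₀ : M} (hx₀ : x₀ ≠ 0) (hyO : IsOrd ρ α (ϖE ^ j) (dualGen ρ Θ α (ϖE ^ j) hM x₀))
    (hyprim : ¬ IsOrd ρ α (ϖE ^ j) (dualGen ρ Θ α (ϖE ^ j) hM x₀ / ϖE)) (hylev : Valued.v (dualGen ρ Θ α (ϖE ^ j) hM x₀) = Valued.v ϖE ^ b)
    {W₀ : M} (hΘW : Θ W₀ = W₀) {r : ℤᵐ⁰} (hr : r ≤ Valued.v ϖE ^ 4)
    (hnear : Valued.v (ρ (hM * (x₀ * Θ x₀)) / (hM * (x₀ * Θ x₀) + ρ (hM * (x₀ * Θ x₀))) - (κ₀ + W₀ * ξ₀)) ≤ r * Valued.v ξ₀) :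
    Valued.v (κ₀ + W₀ * ξ₀) * Valued.v (ϖE ^ j * (α - ρ α)) = Valued.v ϖE ^ b ∧
      ∃ z : M, z * Θ z = ρ (κ₀ + W₀ * ξ₀) / ρ (ρ (hM * (x₀ * Θ x₀)) / (hM * (x₀ * Θ x₀) + ρ (hM * (x₀ * Θ x₀)))) := by
  obtain ⟨hρt, hΘt, ht1⟩ := trace_letters (α := α) hρρ hΘΘ hΘρ hΘh hρϖ hϖ0 hϖ1 hb1 hcc hFgap hyO hyprim hylev
  set u₀ : M := hM * (x₀ * Θ x₀) with hu₀def
  set t : M := u₀ + ρ u₀ with htdef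
  set κh : M := ρ u₀ / t with hκh
  have ht0 : t ≠ 0 := fun h0 => by rw [h0, map_zero] at ht1; exact zero_ne_one ht1
  have hΘu : Θ u₀ = u₀ := by rw [hu₀def, map_mul, map_mul, hΘh, hΘΘ]; ring
  have hu0 : u₀ ≠ 0 := mul_ne_zero hh (mul_ne_zero hx₀ ((map_ne_zero Θ).2 hx₀))
  have hccpos : (0 : ℤᵐ⁰) < Valued.v (ϖE ^ j * (α - ρ α)) := zero_lt_iff.2 ((Valuation.ne_zero_iff _).2 hcc)
  have hξpos : (0 : ℤᵐ⁰) < Valued.v ξ₀ := by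
    refine zero_lt_iff.2 fun h0 => ?_
    rw [h0, zero_mul] at hRξ; exact pow_ne_zero _ ((Valuation.ne_zero_iff _).2 hϖ0) hRξ.symm
  -- `|κ̂| = |u₀| = |ξ₀|`
  have hY : dualGen ρ Θ α (ϖE ^ j) hM x₀ = u₀ * (ϖE ^ j * (α - ρ α)) := by rw [dualGen_def]
  have hu₀v : Valued.v u₀ = Valued.v ξ₀ := by
    have h1 : Valued.v u₀ * Valued.v (ϖE ^ j * (α - ρ α)) = Valued.v ξ₀ * Valued.v (ϖE ^ j * (α - ρ α)) := by
      rw [← Valuation.map_mul, ← hY, hylev, hRξ]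
    exact mul_right_cancel₀ (ne_of_gt hccpos) h1
  have hκv : Valued.v κh = Valued.v ξ₀ := by rw [hκh, map_div₀, hvρ, ht1, div_one, hu₀v]
  have hκ0 : κh ≠ 0 := fun h0 => by rw [h0, map_zero] at hκv; exact (ne_of_gt hξpos) hκv.symm
  have hρκ0 : ρ κh ≠ 0 := (map_ne_zero ρ).2 hκ0
  have hΘκ : Θ κh = κh := by rw [hκh, map_div₀, hΘρ, hΘu, htdef, map_add, hΘρ, hΘu]
  -- the new point is on the sphere (strict ultrametric step)
  have hr1 : r * Valued.v ξ₀ < Valued.v ξ₀ := by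
    have hlt : r < 1 := lt_of_le_of_lt hr (pow_lt_one₀ zero_le hϖlt (by norm_num))
    calc r * Valued.v ξ₀ < 1 * Valued.v ξ₀ := mul_lt_mul_of_pos_right hlt hξpos
      _ = Valued.v ξ₀ := one_mul _
  have hnear' : Valued.v ((κ₀ + W₀ * ξ₀) - κh) < Valued.v κh := by
    rw [Valuation.map_sub_swap, hκv]; exact lt_of_le_of_lt hnear hr1
  have hsph : Valued.v (κ₀ + W₀ * ξ₀) = Valued.v ξ₀ := by
    have e : κ₀ + W₀ * ξ₀ = κh + ((κ₀ + W₀ * ξ₀) - κh) := by ring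
    rw [e, Valuation.map_add_eq_of_lt_left _ hnear', hκv]
  refine ⟨by rw [hsph, hRξ], ?_⟩
  -- the flip `N = ρκ_W ∕ ρκ̂ ≡ 1 (ϖE⁴)` is a `Θ`-norm
  refine hN4 _ (by rw [map_div₀, hΘρ, hΘρ, map_add Θ, map_mul Θ, hΘκ₀, hΘW, hΘξ, hΘκ]) ?_
  have e : ρ (κ₀ + W₀ * ξ₀) / ρ κh - 1 = ρ ((κ₀ + W₀ * ξ₀) - κh) / ρ κh := by rw [map_sub]; field_simp
  rw [e, map_div₀, hvρ, hvρ, hκv, div_le_iff₀ hξpos, Valuation.map_sub_swap]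
  exact hnear.trans (mul_le_mul' hr le_rfl)

/-! ## §3 `LIT` is constant on `|V − V′| ≤ |ϖ|²` -/

/-- **THE LITERAL PREDICATE MOVES ALONG `|W₂ − W₁| ≤ |ϖE|²`.**  ★ (T-b5a)'s HEAD letters (`|2| < 1`, finite residue field, `|ϖE| = exp(−1)`, `Θ`-fixed valuations in `exp(2ℤ)`, `hFN`, `hN4`;
the reference pair with `Tr_ρ κ₀ = 1`, `|ξ₀| > 1`), the radius letter `|ξ₀|·|cc(α − ρα)| = |ϖE|^b`, two doubly-fixed `W₁, W₂` with `|W₂ − W₁| ≤ |ϖE|²`, and ANY scalar `C`: if `κ₀ + W₁ξ₀` is on the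
sphere and `ρ(κ₀ + W₁ξ₀)∕C` is a `Θ`-norm, then so are `κ₀ + W₂ξ₀` and `ρ(κ₀ + W₂ξ₀)∕C`. [cite: Serre1979, Ch. V §2 Prop. 3; §3 Cor. 3 pp. 84–86] [cite: Kottwitz1986BaseChangeUnits, §1 pp. 240–241] -/
theorem sphere_and_flip_of_sub_le [Finite 𝓀[M]] (hρρ : ∀ x, ρ (ρ x) = x) (hvρ : ∀ x, Valued.v (ρ x) = Valued.v x)
    (hΘΘ : ∀ x, Θ (Θ x) = x) (hΘρ : ∀ x, Θ (ρ x) = ρ (Θ x)) (hvΘ : ∀ x, Valued.v (Θ x) = Valued.v x) (h2 : Valued.v (2 : M) < 1)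
    {ϖE : M} (hϖM : Valued.v ϖE = exp (-1 : ℤ)) (hρϖ : ρ ϖE = ϖE)
    (hfixΘ : ∀ x : M, Θ x = x → x ≠ 0 → ∃ n : ℤ, Valued.v x = exp (2 * n))
    (hFN : ∀ f : M, ρ f = f → Θ f = f → Valued.v f = 1 → ∃ z : M, z * Θ z = f)
    (hN4 : ∀ u : M, Θ u = u → Valued.v (u - 1) ≤ Valued.v ϖE ^ 4 → ∃ z : M, z * Θ z = u)
    {κ₀ ξ₀ : M} (hκ₀ : κ₀ + ρ κ₀ = 1) (hΘκ₀ : Θ κ₀ = κ₀) (hξ : ρ ξ₀ = -ξ₀) (hΘξ : Θ ξ₀ = ξ₀) (hξ1 : 1 < Valued.v ξ₀)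
    {j b : ℕ} (hRξ : Valued.v ξ₀ * Valued.v (ϖE ^ j * (α - ρ α)) = Valued.v ϖE ^ b)
    {W₁ W₂ : M} (hW₁ : ρ W₁ = W₁) (hΘW₁ : Θ W₁ = W₁) (hW₂ : ρ W₂ = W₂) (hΘW₂ : Θ W₂ = W₂) (hnear : Valued.v (W₂ - W₁) ≤ Valued.v ϖE ^ 2)
    {C : M} (hsph : Valued.v (κ₀ + W₁ * ξ₀) * Valued.v (ϖE ^ j * (α - ρ α)) = Valued.v ϖE ^ b) (hflip : ∃ z : M, z * Θ z = ρ (κ₀ + W₁ * ξ₀) / C) :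
    Valued.v (κ₀ + W₂ * ξ₀) * Valued.v (ϖE ^ j * (α - ρ α)) = Valued.v ϖE ^ b ∧ ∃ z : M, z * Θ z = ρ (κ₀ + W₂ * ξ₀) / C := by
  have hvϖ0 : Valued.v ϖE ≠ 0 := by rw [hϖM]; exact exp_ne_zero
  have hξpos : (0 : ℤᵐ⁰) < Valued.v ξ₀ := lt_trans zero_lt_one hξ1
  have hccpos : (0 : ℤᵐ⁰) < Valued.v (ϖE ^ j * (α - ρ α)) := by
    refine zero_lt_iff.2 fun h0 => ?_
    rw [h0, mul_zero] at hRξ; exact pow_ne_zero _ hvϖ0 hRξ.symm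
  have hsph1 : Valued.v (κ₀ + W₁ * ξ₀) = Valued.v ξ₀ := mul_right_cancel₀ (ne_of_gt hccpos) (by rw [hsph, hRξ])
  have hκ₁0 : κ₀ + W₁ * ξ₀ ≠ 0 := fun h0 => by rw [h0, map_zero] at hsph1; exact (ne_of_gt hξpos) hsph1.symm
  have hρκ₁0 : ρ (κ₀ + W₁ * ξ₀) ≠ 0 := (map_ne_zero ρ).2 hκ₁0
  -- the sphere clause moves (strict ultrametric step: `|ΔW·ξ₀| ≤ |ϖE|²|ξ₀| < |ξ₀|`)
  have hsph2 : Valued.v (κ₀ + W₂ * ξ₀) = Valued.v ξ₀ := by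
    have e : κ₀ + W₂ * ξ₀ = (κ₀ + W₁ * ξ₀) + (W₂ - W₁) * ξ₀ := by ring
    have hlt : Valued.v ((W₂ - W₁) * ξ₀) < Valued.v (κ₀ + W₁ * ξ₀) := by
      rw [Valuation.map_mul, hsph1]
      calc Valued.v (W₂ - W₁) * Valued.v ξ₀ ≤ Valued.v ϖE ^ 2 * Valued.v ξ₀ := mul_le_mul' hnear le_rfl
        _ < 1 * Valued.v ξ₀ := by
          refine mul_lt_mul_of_pos_right ?_ hξpos
          have h2 : (2 : ℤ) • (-1 : ℤ) < 0 := by norm_num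
          rw [hϖM, ← exp_nsmul, ← exp_zero]; exact exp_lt_exp.2 (by exact_mod_cast h2)
        _ = Valued.v ξ₀ := one_mul _
    rw [e, Valuation.map_add_eq_of_lt_left _ hlt, hsph1]
  refine ⟨by rw [hsph2, hRξ], ?_⟩
  -- the flip composes with ★ (T-b5a) HEAD
  obtain ⟨z, hz⟩ := hflip
  obtain ⟨w, hw⟩ := exists_mul_theta_eq_sphere_flip_of_near hρρ hvρ hΘΘ hΘρ hvΘ h2 hϖM hρϖ hfixΘ hFN hN4 hκ₀ hΘκ₀ hξ hΘξ hξ1 hW₁ hΘW₁ hW₂ hΘW₂ hsph1 hnear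
  refine ⟨z * w, ?_⟩
  calc z * w * Θ (z * w) = (z * Θ z) * (w * Θ w) := by rw [map_mul]; ring
    _ = ρ (κ₀ + W₁ * ξ₀) / C * (ρ (κ₀ + W₂ * ξ₀) / ρ (κ₀ + W₁ * ξ₀)) := by rw [hz, hw]
    _ = ρ (κ₀ + W₂ * ξ₀) / C := by rw [mul_comm, div_mul_div_cancel₀ hρκ₁0]

/-! ## §4 Two literal digits carry a flip -/

/-- **THE FLIP BETWEEN TWO LITERAL DIGITS.**  Two cell pairs `(Λ₁, x₁)`, `(Λ₂, x₂)` (their `GEN` letters: `trace_letters`' inputs), two points `κ₁, κ₂` (`κ₁ ≠ 0`) with flips from the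
vertices — `z₁Θz₁ = ρκ₁∕ρκ̂(x₁)`, `z₂Θz₂ = ρκ₂∕ρκ̂(x₂)` — and `hFN` ⟹ `∃ ε, εΘε = ρκ₂∕ρκ₁` (through ★ (T-b5a) (a): `ρκ̂(x₂)∕ρκ̂(x₁)` is a `Θ`-norm).
[cite: Kottwitz1986BaseChangeUnits, §1 pp. 240–241] [cite: Flicker1998UnitaryFL, Prop. 7 p. 84] [cite: Serre1979, Ch. V §2 Prop. 3] -/
theorem exists_flip_of_flips (hρρ : ∀ x, ρ (ρ x) = x) (hΘΘ : ∀ x, Θ (Θ x) = x) (hΘρ : ∀ x, Θ (ρ x) = ρ (Θ x))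
    {hM ϖE : M} (hΘh : Θ hM = hM) (hh : hM ≠ 0) (hρϖ : ρ ϖE = ϖE) (hϖ0 : ϖE ≠ 0) (hϖ1 : Valued.v ϖE ≤ 1)
    {j b : ℕ} (hb1 : 1 ≤ b) (hcc : ϖE ^ j * (α - ρ α) ≠ 0)
    (hFgap : ∀ z : M, ρ z = z → Θ z = z → Valued.v ϖE < Valued.v z → Valued.v z ≤ 1 → Valued.v z = 1)
    (hFN : ∀ f : M, ρ f = f → Θ f = f → Valued.v f = 1 → ∃ z : M, z * Θ z = f)
    {x₁ x₂ : M} (hx₁ : x₁ ≠ 0) (hyO₁ : IsOrd ρ α (ϖE ^ j) (dualGen ρ Θ α (ϖE ^ j) hM x₁))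
    (hyp₁ : ¬ IsOrd ρ α (ϖE ^ j) (dualGen ρ Θ α (ϖE ^ j) hM x₁ / ϖE)) (hylev₁ : Valued.v (dualGen ρ Θ α (ϖE ^ j) hM x₁) = Valued.v ϖE ^ b)
    (hx₂ : x₂ ≠ 0) (hyO₂ : IsOrd ρ α (ϖE ^ j) (dualGen ρ Θ α (ϖE ^ j) hM x₂))
    (hyp₂ : ¬ IsOrd ρ α (ϖE ^ j) (dualGen ρ Θ α (ϖE ^ j) hM x₂ / ϖE)) (hylev₂ : Valued.v (dualGen ρ Θ α (ϖE ^ j) hM x₂) = Valued.v ϖE ^ b)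
    {κ₁ κ₂ : M} (hκ₁0 : κ₁ ≠ 0) {z₁ z₂ : M}
    (hz₁ : z₁ * Θ z₁ = ρ κ₁ / ρ (ρ (hM * (x₁ * Θ x₁)) / (hM * (x₁ * Θ x₁) + ρ (hM * (x₁ * Θ x₁)))))
    (hz₂ : z₂ * Θ z₂ = ρ κ₂ / ρ (ρ (hM * (x₂ * Θ x₂)) / (hM * (x₂ * Θ x₂) + ρ (hM * (x₂ * Θ x₂))))) :
    ∃ ε : M, ε * Θ ε = ρ κ₂ / ρ κ₁ := by
  obtain ⟨hρt₁, hΘt₁, ht₁⟩ := trace_letters (α := α) hρρ hΘΘ hΘρ hΘh hρϖ hϖ0 hϖ1 hb1 hcc hFgap hyO₁ hyp₁ hylev₁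
  obtain ⟨hρt₂, hΘt₂, ht₂⟩ := trace_letters (α := α) hρρ hΘΘ hΘρ hΘh hρϖ hϖ0 hϖ1 hb1 hcc hFgap hyO₂ hyp₂ hylev₂
  obtain ⟨w, hw⟩ := exists_mul_theta_eq_hatKappa_flip (Θ := Θ) hρρ hFN hh hx₁ hρt₁ hΘt₁ ht₁ hρt₂ hΘt₂ ht₂
  -- non-vanishing of the first vertex digit and of the first flip
  set u₁ : M := hM * (x₁ * Θ x₁) with hu₁
  have ht₁0 : u₁ + ρ u₁ ≠ 0 := fun h0 => by rw [h0, map_zero] at ht₁; exact zero_ne_one ht₁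
  have hu₁0 : u₁ ≠ 0 := mul_ne_zero hh (mul_ne_zero hx₁ ((map_ne_zero Θ).2 hx₁))
  have hρκh₁0 : ρ (ρ u₁ / (u₁ + ρ u₁)) ≠ 0 := by rw [map_hatKappa_eq hρρ]; exact div_ne_zero hu₁0 ht₁0
  have hρκ₁0 : ρ κ₁ ≠ 0 := (map_ne_zero ρ).2 hκ₁0
  set u₂ : M := hM * (x₂ * Θ x₂) with hu₂
  have ht₂0 : u₂ + ρ u₂ ≠ 0 := fun h0 => by rw [h0, map_zero] at ht₂; exact zero_ne_one ht₂
  have hu₂0 : u₂ ≠ 0 := mul_ne_zero hh (mul_ne_zero hx₂ ((map_ne_zero Θ).2 hx₂))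
  have hρκh₂0 : ρ (ρ u₂ / (u₂ + ρ u₂)) ≠ 0 := by rw [map_hatKappa_eq hρρ]; exact div_ne_zero hu₂0 ht₂0
  have hz₁0 : z₁ * Θ z₁ ≠ 0 := by rw [hz₁]; exact div_ne_zero hρκ₁0 hρκh₁0
  have hz₁0' : z₁ ≠ 0 := fun h0 => hz₁0 (by rw [h0, zero_mul])
  refine ⟨z₂ * w / z₁, ?_⟩
  have e : z₂ * w / z₁ * Θ (z₂ * w / z₁) = (z₂ * Θ z₂) * (w * Θ w) / (z₁ * Θ z₁) := by
    rw [map_div₀, map_mul]; field_simp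
  rw [e, hz₁, hz₂, hw]
  field_simp

end Summit.HodgeConjecture.HodgeConjecture.Cruxes.H413.F0P3cDyRamTerminalCellSocketLetters

end
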